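import Mathlib

/-!
# Sketch — crux-ideate stmt-QuantumFields-10604 (`DiagonalMirrorRPR`), round 2, ideator 4

First lemmas (finite-dimensional shadows, statements only) of the two idea cards
`thermal-variance-transfer` and `centre-twisted-swap`.
-/

noncomputable section
open scoped BigOperators ComplexConjugate Matrix
open Finset

namespace Summit.QuantumFields.YangMills.Cruxes.DiagonalMirrorRPR.SketchIdeator4

/-- **Thermal variance bound** (card `thermal-variance-transfer`, lever (V1), finite-dimensional
shadow).  For a positive transfer matrix with eigenvalues `λ i ≥ 0` and the matrix `x` of a slab
insertion in its eigenbasis, EVERY two-point trace `∑ᵢⱼ λᵢᵃ λⱼᵇ |xᵢⱼ|²` (the torus correlator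
`Z·⟨X · (mirror image of X̄ at distance b)⟩`, `a + b` = period minus twice the slab width) dominates
the diagonal sum `∑ᵢ λᵢ^(a+b) |xᵢᵢ|²` = `Z · ∑ᵢ pᵢ |X̂ᵢᵢ|²` — i.e. the thermal second moment of the
diagonal matrix elements is bounded by the two-point function at ANY admissible separation. -/
theorem thermalVarianceBound {ι : Type} [Fintype ι] [DecidableEq ι] (lam : ι → ℝ)
    (hlam : ∀ i, 0 ≤ lam i) (x : Matrix ι ι ℂ) (a b : ℕ) :
    ∑ i, lam i ^ (a + b) * ‖x i i‖ ^ 2 ≤ ∑ i, ∑ j, lam i ^ a * lam j ^ b * ‖x i j‖ ^ 2 := by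
  refine Finset.sum_le_sum fun i _ => ?_
  have h := Finset.single_le_sum (f := fun j => lam i ^ a * lam j ^ b * ‖x i j‖ ^ 2)
    (fun j _ => mul_nonneg (mul_nonneg (pow_nonneg (hlam i) a) (pow_nonneg (hlam j) b)) (sq_nonneg _))
    (Finset.mem_univ i)
  have e : lam i ^ (a + b) * ‖x i i‖ ^ 2 = lam i ^ a * lam i ^ b * ‖x i i‖ ^ 2 := by
    rw [pow_add]
  rw [e]
  exact h

/-- **Doubling transfer** (card `thermal-variance-transfer`, lever (V2)): period doubling replaces
the thermal weights `p` by `q ∝ p²`; a thermally almost-deterministic quantity keeps its mean up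
to `√(K · Var_p)` with `K = max pᵢ / ∑ pⱼ²` (`= λ₀ᴺ Z_N / Z_{2N} = (1+ζ(N))/(1+ζ(2N))`, the
Casimir ratio of the card). -/
theorem doublingTransfer {ι : Type} [Fintype ι] [Nonempty ι] (p : ι → ℝ) (hp : ∀ i, 0 ≤ p i)
    (hp1 : ∑ i, p i = 1) (X : ι → ℝ) :
    let s2 : ℝ := ∑ i, p i ^ 2
    let q : ι → ℝ := fun i => p i ^ 2 / s2
    let m : ℝ := ∑ i, p i * X i
    (∑ i, q i * X i - m) ^ 2 ≤ ((Finset.univ.sup' Finset.univ_nonempty p) / s2) * ∑ i, p i * (X i - m) ^ 2 := by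
  sorry

/-- **Twisted trace transfer** (card `thermal-variance-transfer`, lever (V3)): inserting a
`±1`-valued grading `u` (the half-turn twist `U_{Ne₁}` commuting with the transfer matrix) moves
the mean of a thermally almost-deterministic quantity by at most `√Var / τ`, `τ = ∑ pᵢ uᵢ =
Z(T̃_N)/Z(T''_N)` the twist ratio. -/
theorem twistTransfer {ι : Type} [Fintype ι] (p : ι → ℝ) (hp : ∀ i, 0 ≤ p i) (hp1 : ∑ i, p i = 1)
    (u : ι → ℝ) (hu : ∀ i, u i = 1 ∨ u i = -1) (τ : ℝ) (hτ : 0 < τ) (hτ' : τ = ∑ i, p i * u i)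
    (X : ι → ℝ) :
    let m : ℝ := ∑ i, p i * X i
    ((∑ i, p i * u i * X i) / τ - m) ^ 2 ≤ (∑ i, p i * (X i - m) ^ 2) / τ ^ 2 := by
  sorry

/-- **Centre-twisted Schur positivity** (card `centre-twisted-swap`, first lemma): if `z` is
represented by `−1`, the diagonal-cut plaquette weight at NEGATIVE coupling,
`exp(β Re tr ρ(z·a·b⁻¹))`, `β ≤ 0`, is a positive-semidefinite kernel in `(a, b)` on the group —
because it equals `exp(|β| Re tr ρ(a b⁻¹))`. -/
theorem centreTwistedSchur {G : Type} [Group G] {n : ℕ} (ρ : G →* Matrix (Fin n) (Fin n) ℂ)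
    (hρ : ∀ g, ρ g ∈ Matrix.unitaryGroup (Fin n) ℂ) (z : G) (hz : ρ z = -1) (β : ℝ) (hβ : β ≤ 0)
    (m : ℕ) (g : Fin m → G) (c : Fin m → ℂ) :
    0 ≤ (∑ i, ∑ j, conj (c i) * c j *
      (Real.exp (β * ((ρ (z * g i * (g j)⁻¹)).trace).re) : ℂ)).re := by
  sorry

end Summit.QuantumFields.YangMills.Cruxes.DiagonalMirrorRPR.SketchIdeator4
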